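import Summits.CriticalPhenomena.PercolationContinuityZ3.Theorems.PercNearOneGluingNoHeavyLowerTailSunflowerMultiPetalKempeMarkedUnpaired
import Summits.CriticalPhenomena.PercolationContinuityZ3.Theorems.PercNearOneGluingNoHeavyLowerTailSunflowerMultiPetalKempeMarkedConcave
import HarnessLib
import HarnessLib.Audit

/-!
# `NoHeavyLowerTail` (crux stmt-CriticalPhenomena-4575), marked-multigraph layer: THEOREM U — the UNPAIRED neighbourhood step law at graph level

Support file (seat `prim-l12-p2` gen 54; `--supports stmt-CriticalPhenomena-4575`; sequel of `…KempeMarkedUnpaired` (cell heart) using the contraction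
bookkeeping of `…KempeMarkedContract` / `…KempeMarkedFree` / `…KempeMarkedConcave`).  No `sorry`; nothing is asserted about the crux.
Memo: run/shared/lean/prim/prim-l12/prim-l12-p2/FINDING-g54-UNPAIRED-ALL-D-LAW.md §1–§3.

* `TfunM_uvGraph`: the double-merge minor `(K−y)/((S∖s)∪u → u)/(s∪v → v)`, realised on `V` as `(K.peelContract y (S.erase s) u).contractOne s v`, has
  `T = 3^{|S|}·uvSum s`;
* `TfunM_blockGraph`: the `u`-marked block contraction `((K−y)/(S → w))⁺ᵘ`, realised as `(K.peelContract y (S.erase w) w).addMark u 1`, has `T = 3^{|S|−1}·blockSum`;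
* **`TfunM_step_unpaired` (THEOREM U)**: for `u ≠ v`, `y` unmarked with `mul y u ≠ 0`, `mul y v = 0`, `S = N(y) ∖ {u,v}`, `|S| ≥ 2`, `w ∈ S`:
  `2·3^{|S|}·T(K.isolate y) + 2·T(K.peelContract y S u) + 6·T((K.peelContract y (S∖w) w)⁺ᵘ) + Σ_{s∈S} T((K.peelContract y (S∖s) u).contractOne s v)
   ≤ 2·3^{|S|+1}·T(K)`, i.e. `T(K) ≥ T(K−y) + T(K'/(S∪u)) + T((K'/S)⁺ᵘ) + ½Σ_s T(K'/((S∖s)∪u)/(s∪v))` — valid for EVERY outer degree, with every row of the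
  expansion nonnegative on its own (no `Φ_u` pairing), which is the form that transfers to the fractional-mark functionals `TI_{P,Q}` (memo §3, FINDING-g53 §1).
-/

namespace Summit.CriticalPhenomena.PercolationContinuityZ3.Theorems.SunflowerPartition.Kempe

open Finset

namespace MGraph

variable {V : Type*} [Fintype V] [LinearOrder V] (K : MGraph V)

/-! ## The two new kernels as `T` of actual minors -/

section UnpairedKernels

/-- **Three-to-one at colour `1`**: summing `G (ρ[x ↦ 1])` over the terminal-coloured colourings counts every colouring with `ρ x = 1` three times. [this work] -/
theorem sum_update_one_eq_three_mul (x u v : V) (hux : u ≠ x) (hvx : v ≠ x) (G : (V → Fin 3) → ℤ) :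
    ∑ ρ ∈ univ.filter (fun ρ : V → Fin 3 => ρ u = 0 ∧ ρ v = 1), G (Function.update ρ x 1)
      = 3 * ∑ ρ ∈ univ.filter (fun ρ : V → Fin 3 => ρ u = 0 ∧ ρ v = 1), (if ρ x = 1 then G ρ else 0) := by
  rw [sum_terminal_eq_sum_extCol x u v hux hvx, sum_terminal_eq_sum_extCol x u v hux hvx, mul_sum]
  refine sum_congr rfl fun τ _ => ?_
  rw [Fin.sum_univ_three, Fin.sum_univ_three, update_extCol, update_extCol, update_extCol, extCol_self, extCol_self, extCol_self]
  have h0 : ¬((0 : Fin 3) = 1) := by decide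
  have h2 : ¬((2 : Fin 3) = 1) := by decide
  rw [if_pos rfl, if_neg h0, if_neg h2]
  ring

omit [Fintype V] in
/-- A free vertex other than `s`, `u` stays free under the contraction of `s` into `u`. [this work] -/
theorem isFree_contractOne_of_isFree {z : V} (hz : K.IsFree z) (s u : V) (hzs : z ≠ s) (hzu : z ≠ u) : (K.contractOne s u).IsFree z := by
  have hsz : K.mul s z = 0 := by rw [K.symm s z]; exact hz.1 s
  constructor
  · intro w
    unfold contractOne addAtU isolate
    simp only [hzs, hzu, false_or, if_false, add_zero]
    by_cases hw : w = u
    · simp [hw, hsz, hz.1 u]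
    · simp [hw, hz.1 w]
  · unfold contractOne addAtU isolate
    simp [hzs, hzu, hz.2]

/-- **THE DOUBLE-MERGE KERNEL**: for `s ∈ S`, `T((K−y)/((S∖s)∪u → u)/(s∪v → v))`, realised on `V` as `(K.peelContract y (S.erase s) u).contractOne s v`,
equals `3^{|S|}·uvSum s`. [this work] -/
theorem TfunM_uvGraph (y u v : V) (S : Finset V) (huy : u ≠ y) (huS : u ∉ S) (hvS : v ∉ S) (hyS : y ∉ S)
    {s : V} (hs : s ∈ S) :
    ((K.peelContract y (S.erase s) u).contractOne s v).TfunM u v = 3 ^ S.card * K.uvSum y S s u v := by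
  have hsu : s ≠ u := fun e => huS (e ▸ hs)
  have hsv : s ≠ v := fun e => hvS (e ▸ hs)
  have hsy : s ≠ y := fun e => hyS (e ▸ hs)
  set L := K.peelContract y (S.erase s) u with hL
  set F := univ.filter (fun ρ : V → Fin 3 => ρ u = 0 ∧ ρ v = 1) with hF
  have memF : ∀ ρ, ρ ∈ F ↔ ρ u = 0 ∧ ρ v = 1 := fun ρ => by rw [hF, mem_filter]; simp
  -- (1) contract s into v: types are the types of L at ρ[s ↦ 1]; three-to-one
  have h1 : (L.contractOne s v).TfunM u v = 3 * ∑ ρ ∈ F, (if ρ s = 1 then fC (L.ctypeM ρ) else 0) := by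
    unfold TfunM
    rw [← sum_update_one_eq_three_mul s u v hsu.symm hsv.symm (fun ρ => fC (L.ctypeM ρ))]
    refine sum_congr rfl fun ρ hρ => ?_
    rw [L.ctypeM_contractOne_update s v hsv ρ, ((memF ρ).1 hρ).2]
  -- (2) pin the free vertices S.erase s of L to colour 0
  have hZ : ∀ z ∈ S.erase s, L.IsFree z := fun z hz => K.isFree_peelContract_of_mem y u (S.erase s) hz
  have hcard : (S.erase s).card = S.card - 1 := card_erase_of_mem hs
  have h2 := L.sum_filter_eq_pow_mul fC (S.erase s) hZ (fun σ => (σ u = 0 ∧ σ v = 1) ∧ σ s = 1)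
    (fun z hz σ c => by
      have hzu : z ≠ u := fun e => huS (e ▸ (mem_erase.1 hz).2)
      have hzv : z ≠ v := fun e => hvS (e ▸ (mem_erase.1 hz).2)
      have hzs : z ≠ s := (mem_erase.1 hz).1
      rw [Function.update_of_ne hzu.symm, Function.update_of_ne hzv.symm, Function.update_of_ne hzs.symm])
    (fun _ _ => 0) (fun _ _ _ _ _ _ => rfl)
  -- (3) on the pinned colourings the type is the type in K.isolate y
  have h3 : ∑ σ ∈ univ.filter (fun σ : V → Fin 3 => ((σ u = 0 ∧ σ v = 1) ∧ σ s = 1) ∧ ∀ z ∈ S.erase s, σ z = (0 : Fin 3)), fC (L.ctypeM σ)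
      = ∑ σ ∈ univ.filter (fun σ : V → Fin 3 => ((σ u = 0 ∧ σ v = 1) ∧ σ s = 1) ∧ ∀ z ∈ S.erase s, σ z = (0 : Fin 3)), fC ((K.isolate y).ctypeM σ) := by
    refine sum_congr rfl fun σ hσ => ?_
    obtain ⟨⟨⟨hu, -⟩, -⟩, hz⟩ := (mem_filter.1 hσ).2
    rw [hL, K.ctypeM_peelContract_of_const y u (S.erase s) huy (fun h => huS ((mem_erase.1 h).2)) (fun h => hyS ((mem_erase.1 h).2)) σ
      (fun z hz' => by rw [hz z hz', hu])]
  -- (4) rewrite the pinned filter as the uvSum indicator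
  have h4 : ∑ σ ∈ univ.filter (fun σ : V → Fin 3 => ((σ u = 0 ∧ σ v = 1) ∧ σ s = 1) ∧ ∀ z ∈ S.erase s, σ z = (0 : Fin 3)), fC ((K.isolate y).ctypeM σ)
      = K.uvSum y S s u v := by
    unfold uvSum
    rw [sum_filter, sum_filter]
    refine sum_congr rfl fun σ _ => ?_
    by_cases hP : σ u = 0 ∧ σ v = 1
    · by_cases hQ : σ s = 1 ∧ ∀ s' ∈ S, s' ≠ s → σ s' = 0
      · rw [if_pos hP, if_pos hQ, if_pos ⟨⟨hP, hQ.1⟩, fun z hz => hQ.2 z (mem_erase.1 hz).2 (mem_erase.1 hz).1⟩]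
      · rw [if_pos hP, if_neg hQ, if_neg (fun h => hQ ⟨h.1.2, fun s' hs' hne => h.2 s' (mem_erase.2 ⟨hne, hs'⟩)⟩)]
    · rw [if_neg hP, if_neg (fun h => hP h.1.1)]
  have h5 : ∑ ρ ∈ F, (if ρ s = 1 then fC (L.ctypeM ρ) else 0) = ∑ σ ∈ univ.filter (fun σ : V → Fin 3 => (σ u = 0 ∧ σ v = 1) ∧ σ s = 1), fC (L.ctypeM σ) := by
    rw [hF, sum_filter, sum_filter]
    refine sum_congr rfl fun σ _ => ?_
    by_cases hP : σ u = 0 ∧ σ v = 1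
    · by_cases hQ : σ s = 1
      · rw [if_pos hP, if_pos hQ, if_pos ⟨hP, hQ⟩]
      · rw [if_pos hP, if_neg hQ, if_neg (fun h => hQ h.2)]
    · rw [if_neg hP, if_neg (fun h => hP h.1)]
  rw [h1, h5, h2, h3, h4, hcard, ← mul_assoc]
  congr 1
  have hc : 1 ≤ S.card := card_pos.2 ⟨s, hs⟩
  rw [← pow_succ']
  congr 1
  omega

/-- **THE MARKED BLOCK KERNEL**: for `w ∈ S`, `T(((K−y)/(S → w))⁺ᵘ)`, realised on `V` as `(K.peelContract y (S.erase w) w).addMark u 1`, equals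
`3^{|S|−1}·blockSum`. [this work] -/
theorem TfunM_blockGraph (y u v : V) (S : Finset V) (huS : u ∉ S) (hvS : v ∉ S) (hyS : y ∉ S)
    {w : V} (hw : w ∈ S) :
    ((K.peelContract y (S.erase w) w).addMark u 1).TfunM u v = 3 ^ (S.card - 1) * K.blockSum y S u v := by
  have hwu : w ≠ u := fun e => huS (e ▸ hw)
  have hwv : w ≠ v := fun e => hvS (e ▸ hw)
  have hwy : w ≠ y := fun e => hyS (e ▸ hw)
  set L := K.peelContract y (S.erase w) w with hL
  -- pin the free vertices S.erase w of L⁺ᵘ to the colour of w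
  have hZ : ∀ z ∈ S.erase w, (L.addMark u 1).IsFree z := fun z hz =>
    L.isFree_addMark u 1 (K.isFree_peelContract_of_mem y w (S.erase w) hz) (fun e => huS (e ▸ (mem_erase.1 hz).2))
  have hcard : (S.erase w).card = S.card - 1 := card_erase_of_mem hw
  have h2 := (L.addMark u 1).sum_filter_eq_pow_mul fC (S.erase w) hZ (fun σ => σ u = 0 ∧ σ v = 1)
    (fun z hz σ c => by
      have hzu : z ≠ u := fun e => huS (e ▸ (mem_erase.1 hz).2)
      have hzv : z ≠ v := fun e => hvS (e ▸ (mem_erase.1 hz).2)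
      rw [Function.update_of_ne hzu.symm, Function.update_of_ne hzv.symm])
    (fun _ σ => σ w) (fun z hz z' hz' σ c => by rw [Function.update_of_ne (fun e : w = z' => (mem_erase.1 hz').1 e.symm)])
  -- on the pinned colourings the type is type_{K−y} ⊕ e₀
  have h3 : ∑ σ ∈ univ.filter (fun σ : V → Fin 3 => (σ u = 0 ∧ σ v = 1) ∧ ∀ z ∈ S.erase w, σ z = σ w), fC ((L.addMark u 1).ctypeM σ)
      = ∑ σ ∈ univ.filter (fun σ : V → Fin 3 => (σ u = 0 ∧ σ v = 1) ∧ ∀ z ∈ S.erase w, σ z = σ w), fC (ctAdd ((K.isolate y).ctypeM σ) (1, 0, 0)) := by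
    refine sum_congr rfl fun σ hσ => ?_
    obtain ⟨⟨hu, -⟩, hz⟩ := (mem_filter.1 hσ).2
    rw [L.ctypeM_addMark u 1 σ, hu, xPart_zero_mark, hL,
      K.ctypeM_peelContract_of_const y w (S.erase w) hwy (notMem_erase w S) (fun h => hyS ((mem_erase.1 h).2)) σ hz]
  -- the pinned filter is the 'constant on S' indicator
  have h4 : ∑ σ ∈ univ.filter (fun σ : V → Fin 3 => (σ u = 0 ∧ σ v = 1) ∧ ∀ z ∈ S.erase w, σ z = σ w), fC (ctAdd ((K.isolate y).ctypeM σ) (1, 0, 0))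
      = K.blockSum y S u v := by
    unfold blockSum
    rw [sum_filter, sum_filter]
    refine sum_congr rfl fun σ _ => ?_
    have hiff : (∀ z ∈ S.erase w, σ z = σ w) ↔ ((∀ s ∈ S, σ s = 0) ∨ (∀ s ∈ S, σ s = 1) ∨ (∀ s ∈ S, σ s = 2)) := by
      constructor
      · intro h
        have hall : ∀ s ∈ S, σ s = σ w := fun s hs => by
          by_cases e : s = w
          · rw [e]
          · exact h s (mem_erase.2 ⟨e, hs⟩)
        have tri : ∀ c : Fin 3, c = 0 ∨ c = 1 ∨ c = 2 := by decide
        rcases tri (σ w) with hc | hc | hc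
        · exact Or.inl fun s hs => (hall s hs).trans hc
        · exact Or.inr (Or.inl fun s hs => (hall s hs).trans hc)
        · exact Or.inr (Or.inr fun s hs => (hall s hs).trans hc)
      · intro h z hz
        have hzS := (mem_erase.1 hz).2
        rcases h with h | h | h
        · rw [h z hzS, h w hw]
        · rw [h z hzS, h w hw]
        · rw [h z hzS, h w hw]
    by_cases hP : σ u = 0 ∧ σ v = 1
    · rw [if_pos hP]
      by_cases hQ : ∀ z ∈ S.erase w, σ z = σ w
      · rw [if_pos ⟨hP, hQ⟩, if_pos (hiff.1 hQ)]
      · rw [if_neg (fun h => hQ h.2), if_neg (fun h => hQ (hiff.2 h))]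
    · rw [if_neg hP, if_neg (fun h => hP h.1)]
  unfold TfunM
  rw [h2, h3, h4, hcard]

end UnpairedKernels

/-! ## The unpaired step law at graph level -/

section UnpairedStep

/-- **THEOREM U — THE UNPAIRED NEIGHBOURHOOD STEP LAW, kernel-checked for every outer degree `|S| ≥ 2`** (memo FINDING-g54 §1; same-vertex-type form): for
terminals `u ≠ v`, an UNMARKED non-terminal `y` with `mul y u ≠ 0`, `mul y v = 0`, `S = N(y) ∖ {u,v}` with `|S| ≥ 2`, and any `w ∈ S`,
`2·3^{|S|}·T(K.isolate y) + 2·T(K.peelContract y S u) + 6·T((K.peelContract y (S∖w) w)⁺ᵘ) + Σ_{s∈S} T((K.peelContract y (S∖s) u).contractOne s v) ≤ 2·3^{|S|+1}·T(K)`,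
i.e. `T(K−y) + T(K'/(S∪u)) + T((K'/S)⁺ᵘ) + ½ Σ_s T(K'/((S∖s)∪u)/(s∪v)) ≤ T(K)` after removing the factors `3` of the free vertices.  No pairing of rows: every
row of the expansion is nonnegative on its own (`sum_resU2_nonneg`), which is what the transfer to the fractional-mark hierarchy `TI_{P,Q}` requires. [this work] -/
theorem TfunM_step_unpaired (u v y : V) (huv : u ≠ v) (hyu : y ≠ u) (hyv : y ≠ v) (hmark : K.mark y = 0) (hadj : K.mul y u ≠ 0) (hfar : K.mul y v = 0)
    (S : Finset V) (hS : ∀ w, w ∈ S ↔ (w ≠ u ∧ w ≠ v ∧ w ≠ y ∧ K.mul y w ≠ 0)) (htwo : 2 ≤ S.card) {w : V} (hw : w ∈ S) :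
    2 * 3 ^ S.card * (K.isolate y).TfunM u v + 2 * (K.peelContract y S u).TfunM u v
      + 6 * ((K.peelContract y (S.erase w) w).addMark u 1).TfunM u v
      + ∑ s ∈ S, ((K.peelContract y (S.erase s) u).contractOne s v).TfunM u v
      ≤ 2 * 3 ^ (S.card + 1) * K.TfunM u v := by
  have huS : u ∉ S := fun h => ((hS u).1 h).1 rfl
  have hvS : v ∉ S := fun h => ((hS v).1 h).2.1 rfl
  have hyS : y ∉ S := fun h => ((hS y).1 h).2.2.1 rfl
  have hcell := unpaired_cell_ineq (K := K) hS huv hyu hyv hmark hadj hfar htwo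
  have hA := K.TfunM_peelContract y u v S hyu.symm huS hyS hvS
  have hB := K.TfunM_blockGraph y u v S huS hvS hyS hw
  have hC : ∑ s ∈ S, ((K.peelContract y (S.erase s) u).contractOne s v).TfunM u v = 3 ^ S.card * ∑ s ∈ S, K.uvSum y S s u v := by
    rw [mul_sum]
    exact sum_congr rfl fun s hs => K.TfunM_uvGraph y u v S hyu.symm huS hvS hyS hs
  have hpow : (3 : ℤ) ^ S.card = 3 * 3 ^ (S.card - 1) := by
    rw [← pow_succ']; congr 1; omega
  rw [hA, hB, hC, pow_succ]
  have hp : (0 : ℤ) ≤ 3 ^ (S.card - 1) := by positivity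
  have key := mul_le_mul_of_nonneg_left hcell hp
  rw [hpow]
  nlinarith [key]

end UnpairedStep

end MGraph

end Summit.CriticalPhenomena.PercolationContinuityZ3.Theorems.SunflowerPartition.Kempe
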